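import Summits.Ventures.PercRepro.ProfileGapMonoThresholdTopLongFlat

/-!
# PercRepro — THE ROW `(q − 1, q)` AND THE COLOOP BAND CASE AT EVERY `q`, ON A MATROID WITH A RANK-`(q−1)` FLAT OF
`ν + q − 2` POINTS (p5, gen 30; `proofs/P5-GM1.md` §41(h); announced INBOX 13953)

The corollaries of `thresholdIneq_top_of_long_flat` in the cell's row vocabulary: on a coloop-free matroid of rank
exactly `q` with a rank-`(q−1)` flat of `ν + q − 2` points the top threshold `t = q − 1` is the row `(q − 1, q)`
(`thresholdIneq_iff_row`), so **`profileIneqMinusQ_pred_of_long_flat`** : `ProfileIneqMinusQ N (q − 1) q` and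
**`profileIneq_pred_of_long_flat`** : `ProfileIneq N (q − 1) q`; and when `M ∖ z` is coloop-free of rank `q + 2` with
such a flat, `t = q + 1` is its top threshold, so **`starQ_succ_of_long_flat`** : `StarQ M z q (q + 1)` and, at a
coloop `z`, **`gapMonoQ_coloop_succ_of_long_flat`** : `GapMonoQ M z q (q + 1)` — `(GM)_q` at a coloop at the level
`u = q + 1` in this regime, for every `q ≥ 2`.  Nothing open is asserted.
-/

open scoped Matroid

namespace PercRepro.Cogirth

open Finset ThmH Skew Shadow Profile

variable {α : Type} [DecidableEq α] {N : Matroid α} [N.Finite] {q : ℕ}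

/-- **THE ROW `(q − 1, q)` OF `Π⁻`** on a rank-`q` coloop-free matroid with a rank-`(q−1)` flat of `ν + q − 2`
points (`2 ≤ q`). -/
theorem profileIneqMinusQ_pred_of_long_flat (hq : 2 ≤ q)
    (hcf : ∀ z ∈ gr N, rk N ((gr N).erase z) = rk N (gr N)) {B : Finset α} (hB : B ∈ Rq N (q - 1))
    (hlong : (clF N B).card + rk N (gr N) = (gr N).card + (q - 2)) (hR : rk N (gr N) = q) :
    ProfileIneqMinusQ N (q - 1) q := by
  have h := thresholdIneq_top_of_long_flat hq hcf hB hlong (by omega)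
  rw [hR] at h
  exact (thresholdIneq_iff_row (by omega)).1 h

/-- **THE ROW `(Π_{q−1,q})`** on a rank-`q` coloop-free matroid with a rank-`(q−1)` flat of `ν + q − 2` points. -/
theorem profileIneq_pred_of_long_flat (hq : 2 ≤ q)
    (hcf : ∀ z ∈ gr N, rk N ((gr N).erase z) = rk N (gr N)) {B : Finset α} (hB : B ∈ Rq N (q - 1))
    (hlong : (clF N B).card + rk N (gr N) = (gr N).card + (q - 2)) (hR : rk N (gr N) = q) :
    ProfileIneq N (q - 1) q :=
  profileIneq_of_minusQ (by omega) (profileIneqMinusQ_pred_of_long_flat hq hcf hB hlong hR)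

/-- **`(★_q)` at the level `u = q + 1`** at a point `z` whose deletion is coloop-free of rank `q + 2` with a
rank-`(q−1)` flat of `ν + q − 2` points (`2 ≤ q`). -/
theorem starQ_succ_of_long_flat {M : Matroid α} [M.Finite] {z : α} (hq : 2 ≤ q)
    (hcf : ∀ w ∈ gr (M ＼ ({z} : Set α)), rk (M ＼ ({z} : Set α)) ((gr (M ＼ ({z} : Set α))).erase w) =
      rk (M ＼ ({z} : Set α)) (gr (M ＼ ({z} : Set α))))
    {B : Finset α} (hB : B ∈ Rq (M ＼ ({z} : Set α)) (q - 1))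
    (hlong : (clF (M ＼ ({z} : Set α)) B).card + rk (M ＼ ({z} : Set α)) (gr (M ＼ ({z} : Set α))) =
      (gr (M ＼ ({z} : Set α))).card + (q - 2))
    (hR : rk (M ＼ ({z} : Set α)) (gr (M ＼ ({z} : Set α))) = q + 2) : StarQ M z q (q + 1) := by
  have h := thresholdIneq_top_of_long_flat hq hcf hB hlong (by omega)
  rw [hR, show q + 2 - 1 = q + 1 by omega] at h
  exact (starQ_succ_iff_thresholdIneq (by omega)).2 h

/-- **`(GM)_q` at a coloop `z` at the level `u = q + 1`** when `M ∖ z` is coloop-free of rank `q + 2` with a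
rank-`(q−1)` flat of `ν + q − 2` points — the coloop band case of the hard rule's dispatch at co-rank `q` in this
regime (`gapMonoQ_of_coloop_of_starQ` with the trivial row `(q, q)` of `M ∖ z`). -/
theorem gapMonoQ_coloop_succ_of_long_flat {M : Matroid α} [M.Finite] {z : α} (hq : 2 ≤ q) (hz : z ∈ gr M)
    (hzc : rk M ((gr M).erase z) + 1 = rk M (gr M))
    (hcf : ∀ w ∈ gr (M ＼ ({z} : Set α)), rk (M ＼ ({z} : Set α)) ((gr (M ＼ ({z} : Set α))).erase w) =
      rk (M ＼ ({z} : Set α)) (gr (M ＼ ({z} : Set α))))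
    {B : Finset α} (hB : B ∈ Rq (M ＼ ({z} : Set α)) (q - 1))
    (hlong : (clF (M ＼ ({z} : Set α)) B).card + rk (M ＼ ({z} : Set α)) (gr (M ＼ ({z} : Set α))) =
      (gr (M ＼ ({z} : Set α))).card + (q - 2))
    (hR : rk (M ＼ ({z} : Set α)) (gr (M ＼ ({z} : Set α))) = q + 2) : GapMonoQ M z q (q + 1) := by
  have hrow : ProfileIneqMinusQ (M ＼ ({z} : Set α)) q (q + 1 - 1) := by
    rw [Nat.add_sub_cancel]
    exact profileIneqMinusQ_self (M ＼ ({z} : Set α)) q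
  exact gapMonoQ_of_coloop_of_starQ hz hzc (by omega) (by omega) hrow (starQ_succ_of_long_flat hq hcf hB hlong hR)

end PercRepro.Cogirth
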